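/-
Copyright (c) 2026 the pub-hodgecm-mathlib formalisation cell (harness21).  Prover seat hodgecm-mathlib-K2Liu-p09 (g6): Track B «K2-LIT»,
hLiu418 = stmt-HodgeConjecture-24832; LEAD F0P6-plan RULING M-158d «A7-val road (σ)», file V8b (the laws of the two functionals of the (A4″-KR) assembly).
-/
import Summits.HodgeConjecture.HodgeConjecture.Theorems.K2LiuA7ValueMap   -- ★ V8a p859922 (`exists_valueMap`, `valueMap_translate`, `valueMap_siegel`, `valueMap_apply_unipDelta`)
import HarnessLib

/-!
# Crux `HLiu418`, road `K2_Liu`, organ A7-val, file V8b: THE LAWS OF THE TWO FUNCTIONALS `T_ℳ = ℳ ∘ 𝒜` AND `T_B` OF THE (A4″-KR) ASSEMBLY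

Cell `hodgecm-mathlib`, crux item hLiu418 = `stmt-HodgeConjecture-24832`; squad K2 ∕ K2Liu; prover K2Liu-p09 (g6), organ lead A7-val.  THEOREMS ONLY; lane
`--supports stmt-HodgeConjecture-24832` (count-neutral helper).  RANK-GENERIC and MODEL-GENERIC: the Weil-type action of `H_v` on the coefficient space `V`
(at the instance: `V = 𝒮(X_{Δ,B})`, `ω(u) = toRep (s^Δ_B u)` of ★ β-1) enters ONLY through its laws, so that every CM-specific elaboration is confined to the
instance file; each binder names its payer.
* §1 the `ℳ`-side (`ℳ = ℳ_{K₀}` a value map of ★ V8a, `𝒜 : V →ₗ[ℂ] I_v(½, χ_v)` a SECTION MAP with `𝒜 (ω(u) Φ) = (𝒜 Φ)(· u)` — binder `h𝒜`, paid by ★ β-1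
  `swSectionDelta_mul_right`): `valueMap_sectionMap_toRep` (`ℳ (𝒜 (ω u Φ)) h = ℳ (𝒜 Φ) (h u)`), `valueMap_sectionMap_apply`, `valueMap_sectionMap_levi` (for
  `p ∈ P_Δ` with `ω(p) = c • A` — ★ A2c∕A2d junction pin —: `ℳ (𝒜 (A Φ)) 1 = (c⁻¹ χ′_{−½}(p)) · ℳ (𝒜 Φ) 1`), `valueMap_sectionMap_unip` (`u ∈ N_Δ`: invariance),
  `valueMap_sectionMap_of_invariant`.
* §2 the `B`-side (`B : V →ₗ[ℂ] (H_v → ℂ)` with `B (ω(u) Φ) h = B Φ (h u)` — binder `hB`, paid by the (L2) letter of K2Liu-p10 + ★ β-1 — whose values are Siegel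
  sections of `I_v(−½, χ′_v)` — binder `hSiegS`, (L3)): `smallSection_levi`, `smallSection_unip` — the SAME characters as §1, as multiplicity one (★ V5) wants.
HONEST LABEL.  `HC_CM` is proved only modulo the 7 printed citations (2 remaining named inputs: hLiu418 = `stmt-HodgeConjecture-24832`,
h413 = `stmt-HodgeConjecture-24833`) until rung 0 closes.

## References
* [KudlaRallis1994] S. Kudla, S. Rallis, Annals of Math. 140 (1994), §1 (Siegel–Weil sections and their `P`-laws).
* [KudlaSweet1997] S. Kudla, W. J. Sweet, Israel J. Math. 98 (1997), §1, Thm. 1.2.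
* [GanQiuTakeda2014] W. T. Gan, Y. Qiu, S. Takeda, Invent. Math. 198 (2014), §2.7–2.8 (the mixed model and the map `R_n(V′) → R_n(V′₀)`).
-/

set_option autoImplicit false
set_option linter.dupNamespace false -- the mandated namespace repeats `HodgeConjecture.HodgeConjecture`

noncomputable section

open scoped Classical NNReal ENNReal
open NumberField IsDedekindDomain MeasureTheory Topology
open Literature.NumberTheory.GaloisRepresentations Literature.NumberTheory.GaloisRepresentations.IsNonarchimedeanLocalField
open Literature.NumberTheory.Automorphic Literature.NumberTheory.Automorphic.UnitaryGroup
open Literature.NumberTheory.GelbartRogawski1991.UnitaryDualPair.LocalSplitting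
open Literature.NumberTheory.K2Lit.LocalSiegelDoubled
open Summit.HodgeConjecture.HodgeConjecture.Cruxes.HLiu418.K2LiuQRationalDefs
open Summit.HodgeConjecture.HodgeConjecture.Cruxes.HLiu418.K2LiuLocalLFactorDefs
open Summit.HodgeConjecture.HodgeConjecture.Cruxes.HLiu418.K2LiuLocalSiegel
open Summit.HodgeConjecture.HodgeConjecture.Cruxes.HLiu418.K2LiuLocalIntertwiningProperty
open Summit.HodgeConjecture.HodgeConjecture.Cruxes.HLiu418.K2LiuA7ValueMap

namespace Summit.HodgeConjecture.HodgeConjecture.Cruxes.HLiu418.K2LiuA7ValueLaws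

variable (F : Type) [Field F] [NumberField F] (E : Type) [Field E] [NumberField E] [Algebra F E]
  [Algebra.IsQuadraticExtension F E] (c : E ≃ₐ[F] E)
  {δ : E} (hcδ : c δ = -δ) (hδ : δ ≠ 0) {d : F} (hd : δ * δ = algebraMap F E d) (v : HeightOneSpectrum (𝓞 F)) (n : ℕ)
  {T₀ : Matrix (Fin n) (Fin n) F} (hT₀ : T₀.IsSymm) {JD : Matrix (Fin (n + n)) (Fin (n + n)) E} (hJD : JD = (gramD F n T₀).map (algebraMap F E))
  (χv : ∀ w : PlacesOver E v, (w.1.adicCompletion E)ˣ →* ℂˣ) (χv' : ∀ w : PlacesOver E v, (w.1.adicCompletion E)ˣ →* ℂˣ)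
  -- the coefficient space and the Weil-type action of `H_v` on it (instance: `V = 𝒮(X_{Δ,B})`, `ω u = toRep (s^Δ_B u)`)
  {V : Type} [AddCommGroup V] [Module ℂ V] (ω : UnitaryGroup.localPi E c (n + n) JD v → V →ₗ[ℂ] V)

/-! ## §1 The laws of `T_ℳ = ℳ ∘ 𝒜` -/

section ValueSide

variable [MeasurableSpace (unipDeltaLocal F E c v n (JD := JD))] (νN : Measure (unipDeltaLocal F E c v n (JD := JD))) (vol : ℝ)
  (haN : ∀ s : ℂ, 1 < s.re → aNorm F E c v n χv vol s ≠ 0)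
  (K₀ : Subgroup (UnitaryGroup.localPi E c (n + n) JD v))
  (hK₀ : IsCompact (K₀ : Set (UnitaryGroup.localPi E c (n + n) JD v)) ∧ IsOpen (K₀ : Set (UnitaryGroup.localPi E c (n + n) JD v)))
  (hIw : ∀ x : UnitaryGroup.localPi E c (n + n) JD v, ∃ p, IsSiegelDelta F E c hcδ hδ hd v n hT₀ hJD p ∧ ∃ k ∈ K₀, x = p * k)
  (hA4R : ∀ f' : ℂ → UnitaryGroup.localPi E c (n + n) JD v → ℂ, (∀ s, IsLocalSiegelSection F E c hcδ hδ hd v n hT₀ hJD χv s (f' s)) →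
    (∀ s, IsSmooth F E c v n (f' s)) → (∀ s s' : ℂ, ∀ k ∈ K₀, f' s k = f' s' k) →
    ∃ Fn' : ℂ → UnitaryGroup.localPi E c (n + n) JD v → ℂ, (∀ h, IsQRationalRegularAt (residueFieldCard (v.adicCompletion F)) (1 / 2) fun s => Fn' s h) ∧
      ∀ s : ℂ, 1 < s.re → ∀ h, localIntertwining F E c v n hJD νN (f' s) h = aNorm F E c v n χv vol s * Fn' s h)
  (hintA : ∀ f' : ℂ → UnitaryGroup.localPi E c (n + n) JD v → ℂ, (∀ s, IsLocalSiegelSection F E c hcδ hδ hd v n hT₀ hJD χv s (f' s)) →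
    (∀ s, IsSmooth F E c v n (f' s)) → (∀ s s' : ℂ, ∀ k ∈ K₀, f' s k = f' s' k) → ∀ s : ℂ, 1 < s.re → ∀ h,
      Integrable (fun u : unipDeltaLocal F E c v n (JD := JD) => f' s (weylDelta F E c v n hJD * (u : UnitaryGroup.localPi E c (n + n) JD v) * h)) νN)
  (ℳ : ↥(localDegPS F E c hcδ hδ hd v n hT₀ hJD χv (1 / 2)) →ₗ[ℂ] (UnitaryGroup.localPi E c (n + n) JD v → ℂ))
  (hℳ : ∀ (φ : ↥(localDegPS F E c hcδ hδ hd v n hT₀ hJD χv (1 / 2))) (f Fn : ℂ → UnitaryGroup.localPi E c (n + n) JD v → ℂ),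
    (∀ s, IsLocalSiegelSection F E c hcδ hδ hd v n hT₀ hJD χv s (f s)) → (∀ s, IsSmooth F E c v n (f s)) → (∀ s s' : ℂ, ∀ k ∈ K₀, f s k = f s' k) →
    f (1 / 2) = (φ : UnitaryGroup.localPi E c (n + n) JD v → ℂ) →
    (∀ h, IsQRationalRegularAt (residueFieldCard (v.adicCompletion F)) (1 / 2) fun s => Fn s h) →
    (∀ s : ℂ, 1 < s.re → ∀ h, localIntertwining F E c v n hJD νN (f s) h = aNorm F E c v n χv vol s * Fn s h) →
    ∀ h, ℳ φ h = Fn (1 / 2) h)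
  -- the section map (instance: `Φ ↦ f^Δ_Φ`, ★ β-1 `swSectionDelta`; `h𝒜` = ★ `swSectionDelta_mul_right`)
  (𝒜 : V →ₗ[ℂ] ↥(localDegPS F E c hcδ hδ hd v n hT₀ hJD χv (1 / 2)))
  (h𝒜 : ∀ (u : UnitaryGroup.localPi E c (n + n) JD v) (Φ : V) (x : UnitaryGroup.localPi E c (n + n) JD v),
    ((𝒜 (ω u Φ) : ↥(localDegPS F E c hcδ hδ hd v n hT₀ hJD χv (1 / 2))) : UnitaryGroup.localPi E c (n + n) JD v → ℂ) x =
      ((𝒜 Φ : ↥(localDegPS F E c hcδ hδ hd v n hT₀ hJD χv (1 / 2))) : UnitaryGroup.localPi E c (n + n) JD v → ℂ) (x * u))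

omit [MeasurableSpace (unipDeltaLocal F E c v n (JD := JD))] in
include h𝒜 in
/-- `𝒜 (ω(u) Φ)` is the right translate of `𝒜 Φ` by `u`, as a member of `I_v(½, χ_v)`. [cite: KudlaRallis1994, §1] -/
theorem sectionMap_toRep_eq (u : UnitaryGroup.localPi E c (n + n) JD v) (Φ : V) :
    𝒜 (ω u Φ) = ⟨fun x => ((𝒜 Φ : ↥(localDegPS F E c hcδ hδ hd v n hT₀ hJD χv (1 / 2))) : UnitaryGroup.localPi E c (n + n) JD v → ℂ) (x * u),
      comp_mul_right_mem_localDegPS F E c hcδ hδ hd v n hT₀ hJD χv (𝒜 Φ).2 u⟩ :=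
  Subtype.ext (funext (h𝒜 u Φ))

include hcδ hδ hd hT₀ hJD hK₀ hIw hA4R hintA haN hℳ h𝒜 in
/-- **`H_v`-EQUIVARIANCE OF `ℳ ∘ 𝒜`**: `ℳ (𝒜 (ω(u) Φ)) h = ℳ (𝒜 Φ) (h u)` (★ V8a `valueMap_translate`). [cite: KudlaSweet1997, §1] [cite: KudlaRallis1994, §1] -/
theorem valueMap_sectionMap_toRep (u : UnitaryGroup.localPi E c (n + n) JD v) (Φ : V) (h : UnitaryGroup.localPi E c (n + n) JD v) :
    ℳ (𝒜 (ω u Φ)) h = ℳ (𝒜 Φ) (h * u) := by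
  rw [sectionMap_toRep_eq F E c hcδ hδ hd v n hT₀ hJD χv ω 𝒜 h𝒜 u Φ]
  exact valueMap_translate F E c hcδ hδ hd v n hT₀ hJD χv νN vol haN K₀ hK₀ hIw hA4R hintA ℳ hℳ (𝒜 Φ) u h

include hcδ hδ hd hT₀ hJD hK₀ hIw hA4R hintA haN hℳ h𝒜 in
/-- the value FUNCTIONAL recovers the value SECTION: `ℳ (𝒜 Φ) u = ℳ (𝒜 (ω(u) Φ)) 1`. [cite: KudlaSweet1997, §1] -/
theorem valueMap_sectionMap_apply (u : UnitaryGroup.localPi E c (n + n) JD v) (Φ : V) : ℳ (𝒜 Φ) u = ℳ (𝒜 (ω u Φ)) 1 := by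
  rw [valueMap_sectionMap_toRep F E c hcδ hδ hd v n hT₀ hJD χv ω νN vol haN K₀ hK₀ hIw hA4R hintA ℳ hℳ 𝒜 h𝒜 u Φ 1, one_mul]

omit [MeasurableSpace (unipDeltaLocal F E c v n (JD := JD))] in
/-- **OPERATORS FIXING EVERY SECTION FIX `ℳ ∘ 𝒜`**: if `𝒜 (A Φ) = 𝒜 Φ` pointwise (e.g. `A = leviEquivSB (1 ⊗ g)`, `g ∈ U(V′_v)`, ★ (A4-avg) §4) then
`ℳ (𝒜 (A Φ)) = ℳ (𝒜 Φ)`. [cite: KudlaRallis1994, §1] [cite: GanQiuTakeda2014, §2.8] -/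
theorem valueMap_sectionMap_of_invariant (A : V →ₗ[ℂ] V)
    (hA : ∀ Φ x, ((𝒜 (A Φ) : ↥(localDegPS F E c hcδ hδ hd v n hT₀ hJD χv (1 / 2))) : UnitaryGroup.localPi E c (n + n) JD v → ℂ) x =
      ((𝒜 Φ : ↥(localDegPS F E c hcδ hδ hd v n hT₀ hJD χv (1 / 2))) : UnitaryGroup.localPi E c (n + n) JD v → ℂ) x)
    (Φ : V) : ℳ (𝒜 (A Φ)) = ℳ (𝒜 Φ) := by
  rw [show 𝒜 (A Φ) = 𝒜 Φ from Subtype.ext (funext (hA Φ))]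

variable [BorelSpace (unipDeltaLocal F E c v n (JD := JD))] [νN.IsMulLeftInvariant]
  (hmod : ∀ (q' : UnitaryGroup.localPi E c (n + n) JD v) (hq : IsSiegelDelta F E c hcδ hδ hd v n hT₀ hJD q'),
    Measure.map (fun u : unipDeltaLocal F E c v n (JD := JD) =>
      (⟨q' * (u : UnitaryGroup.localPi E c (n + n) JD v) * q'⁻¹, conj_mem_unipDeltaLocal F E c hcδ hδ hd v n hT₀ hJD hq u.2⟩ :
        unipDeltaLocal F E c v n (JD := JD))) νN =
      ENNReal.ofReal ((absDetDelta F E c v n q' ^ n)⁻¹) • νN)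
  (hχ' : ∀ (w w' : PlacesOver E v) (h : c • w.1 = w'.1),
    χv' w = (χv w')⁻¹.comp (Units.map (galAdicCompletionMap (L := E) c h : w.1.adicCompletion E →* w'.1.adicCompletion E)))
  (hT₀d : IsUnit T₀.det)

include hcδ hδ hd hT₀ hJD hK₀ hIw hA4R hintA haN hℳ h𝒜 hmod hχ' hT₀d in
/-- **THE LEVI LAW OF `ℳ ∘ 𝒜` AT `1`**: if `p ∈ P_Δ(F_v)` acts on `V` by `ω(p) = c • A` (`c ≠ 0`; at the instance `A = leviEquivSB a`, ★ A2c∕A2d junction pin), then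
`ℳ (𝒜 (A Φ)) 1 = (c⁻¹ · χ′_{−½}(p)) · ℳ (𝒜 Φ) 1` (★ V8a `valueMap_siegel`). [cite: KudlaSweet1997, §1] [cite: KudlaRallis1994, §1] -/
theorem valueMap_sectionMap_levi {p : UnitaryGroup.localPi E c (n + n) JD v} (hp : IsSiegelDelta F E c hcδ hδ hd v n hT₀ hJD p)
    (A : V →ₗ[ℂ] V) {a : ℂ} (ha : a ≠ 0) (hM : ∀ Φ : V, ω p Φ = a • A Φ) (Φ : V) :
    ℳ (𝒜 (A Φ)) 1 = (a⁻¹ * localSiegelCharacter F E c v n χv' (-(1 / 2)) p) * ℳ (𝒜 Φ) 1 := by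
  have hL : A Φ = a⁻¹ • ω p Φ := by
    rw [hM Φ, smul_smul, inv_mul_cancel₀ ha, one_smul]
  rw [hL, map_smul, map_smul, Pi.smul_apply, smul_eq_mul,
    valueMap_sectionMap_toRep F E c hcδ hδ hd v n hT₀ hJD χv ω νN vol haN K₀ hK₀ hIw hA4R hintA ℳ hℳ 𝒜 h𝒜 p Φ 1, one_mul, ← mul_one p,
    valueMap_siegel F E c hcδ hδ hd v n hT₀ hJD χv νN vol haN K₀ hK₀ hIw hA4R ℳ hℳ hmod χv' hχ' hT₀d (𝒜 Φ) hp 1, mul_one, mul_assoc]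

include hcδ hδ hd hT₀ hJD hK₀ hIw hA4R hintA haN hℳ h𝒜 hmod hχ' hT₀d in
/-- **THE `N_Δ`-INVARIANCE OF `ℳ ∘ 𝒜` AT `1`**: `ℳ (𝒜 (ω(u) Φ)) 1 = ℳ (𝒜 Φ) 1` for `u ∈ N_Δ(F_v)` (★ V8a `valueMap_apply_unipDelta`).
[cite: KudlaRallis1994, §1] [cite: HarrisKudlaSweet1996, §1 (1.15)] -/
theorem valueMap_sectionMap_unip (u : unipDeltaLocal F E c v n (JD := JD)) (Φ : V) :
    ℳ (𝒜 (ω (u : UnitaryGroup.localPi E c (n + n) JD v) Φ)) 1 = ℳ (𝒜 Φ) 1 := by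
  rw [valueMap_sectionMap_toRep F E c hcδ hδ hd v n hT₀ hJD χv ω νN vol haN K₀ hK₀ hIw hA4R hintA ℳ hℳ 𝒜 h𝒜 _ Φ 1, one_mul]
  exact valueMap_apply_unipDelta F E c hcδ hδ hd v n hT₀ hJD χv νN vol haN K₀ hK₀ hIw hA4R ℳ hℳ hmod χv' hχ' hT₀d (𝒜 Φ) u

end ValueSide

/-! ## §2 The laws of `T_B` -/

section SmallSide

variable
  -- the small-side section functional (instance: `B Φ = f^{Δ,S}_{r Φ}`; `hB` = (L2) + ★ β-1 `swSectionDelta_mul_right`; `hSiegS` = small Siegel law, (L3))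
  (B : V →ₗ[ℂ] (UnitaryGroup.localPi E c (n + n) JD v → ℂ))
  (hB : ∀ (u : UnitaryGroup.localPi E c (n + n) JD v) (Φ : V) (h : UnitaryGroup.localPi E c (n + n) JD v), B (ω u Φ) h = B Φ (h * u))
  (hSiegS : ∀ Φ : V, IsLocalSiegelSection F E c hcδ hδ hd v n hT₀ hJD χv' (-(1 / 2)) (B Φ))

include hcδ hδ hd hT₀ hJD hB hSiegS in
/-- **THE LEVI LAW OF `T_B` AT `1`** — the SAME character as `valueMap_sectionMap_levi`: for `p ∈ P_Δ(F_v)` with `ω(p) = c • A`,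
`B (A Φ) 1 = (c⁻¹ · χ′_{−½}(p)) · B Φ 1`. [cite: GanQiuTakeda2014, §2.7–2.8] [cite: KudlaRallis1994, §1] -/
theorem smallSection_levi {p : UnitaryGroup.localPi E c (n + n) JD v} (hp : IsSiegelDelta F E c hcδ hδ hd v n hT₀ hJD p)
    (A : V →ₗ[ℂ] V) {a : ℂ} (ha : a ≠ 0) (hM : ∀ Φ : V, ω p Φ = a • A Φ) (Φ : V) :
    B (A Φ) 1 = (a⁻¹ * localSiegelCharacter F E c v n χv' (-(1 / 2)) p) * B Φ 1 := by
  have hL : A Φ = a⁻¹ • ω p Φ := by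
    rw [hM Φ, smul_smul, inv_mul_cancel₀ ha, one_smul]
  rw [hL, map_smul, Pi.smul_apply, smul_eq_mul, hB p Φ 1, one_mul, ← mul_one p, hSiegS Φ p hp 1, mul_one, mul_assoc]

include hcδ hδ hd hT₀ hJD hB hSiegS in
/-- **THE `N_Δ`-INVARIANCE OF `T_B` AT `1`**: `B (ω(u) Φ) 1 = B Φ 1` for `u ∈ N_Δ(F_v)` (`χ′_{−½}|_{N_Δ} = 1`).
[cite: GanQiuTakeda2014, §2.7–2.8] [cite: HarrisKudlaSweet1996, §1 (1.15)] -/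
theorem smallSection_unip (u : unipDeltaLocal F E c v n (JD := JD)) (Φ : V) :
    B (ω (u : UnitaryGroup.localPi E c (n + n) JD v) Φ) 1 = B Φ 1 := by
  rw [hB _ Φ 1, one_mul, ← mul_one (u : UnitaryGroup.localPi E c (n + n) JD v),
    hSiegS Φ _ (isSiegelDelta_of_mem_unipDeltaLocal F E c hcδ hδ hd v n hT₀ hJD u.2) 1,
    localSiegelCharacter_eq_one_of_mem_unipDeltaLocal F E c v n χv' (-(1 / 2)) u.2, one_mul]

end SmallSide

end Summit.HodgeConjecture.HodgeConjecture.Cruxes.HLiu418.K2LiuA7ValueLaws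

end
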